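import Literature.AlgebraicGeometry.ComplexMultiplication.CyclotomicFermatCMTypesOddLevelSimple
import HarnessLib

/-!
# Koblitz–Rohrlich's PROPOSITION (§2, p. 1190), structural half: counting the bad odd characters —
# `#S₀(N) ≤ Σ_{p ∣ N} #{ψ mod N_p odd : ψ(p) = 1}` and `#{ψ mod M odd : ψ(u) = 1} = φ(M)/(2·ord u)` or `0`

Layer `Literature/AlgebraicGeometry/ComplexMultiplication`, namespace `…ComplexMultiplication.CyclotomicFermatCMType`; sequel of
`CyclotomicFermatCMTypesOddLevelSimple` (Koblitz–Rohrlich's LEMMA and Theorems 1–2 in the relatively prime case at any odd level `N` UNDER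
the hypothesis `12·#S₀(N) < φ(N)`, `S₀(N)` = the odd Dirichlet characters `χ` modulo `N` with `B_{1,χ} = 0`).  THEOREMS ONLY (no definition,
no named fact, no `sorry`).  Koblitz–Rohrlich prove that hypothesis for every `N` prime to `6` ("PROPOSITION. Suppose `2, 3 ∤ N`.  Let `S(N)`
be the set of odd characters of `(ℤ/Nℤ)*`, and let `S₀(N) ⊂ S(N)` be the set of "bad" characters, i.e., `S₀(N) = {χ ∈ S(N) | B_{1,χ} = 0}`.
Then `#S₀(N) < (1/6)#S(N)`.") in two halves: a STRUCTURAL count — "Proof. For `χ ∈ S(N)` let `N₀ | N` be the conductor of `χ`, and let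
`χ₀` be the character mod `N₀` which induces `χ`.  Then `B_{1,χ} = B_{1,χ₀} ∏_{p|N} (1 − χ₀(p))`.  Thus `χ ∈ S₀(N)` if and only if there
exists `p | N/N₀` such that `χ₀(p) = 1`.  Let `N = ∏_{i=1}^m pᵢ^{aᵢ}` be the prime factorization.  Let `Nᵢ = N/pᵢ^{aᵢ}`, and let `ordᵢ`
denote the order of `pᵢ` in `(ℤ/Nᵢℤ)*`.  If `χ ∈ S₀(N)`, then for some `i` the corresponding `χ₀` must be an odd character mod `Nᵢ` such
that `χ₀(pᵢ) = 1`.  For fixed `i`, the number of such `χ₀` is `0` if `pᵢ` is a root of `−1 mod Nᵢ`, `½·#((ℤ/Nᵢℤ)*/{pᵢʲ})` otherwise.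
Thus, `#S₀(N)/#S(N) ≤ Σᵢ …`" — and an ARITHMETIC estimate of the resulting sum `s(N)` (pp. 1190–1193, "TABLE 1. All primes `≥ 5` dividing
`pᵐ − 1` for certain `p` and `m`", Cases 1–4).  THIS FILE TYPES THE STRUCTURAL HALF, for every `N ≥ 1`; the arithmetic half is left to
level-specific sequels (two prime factors: `CyclotomicFermatCMTypesTwoPrimeLevelSimple`).

## The print

* N. Koblitz, D. Rohrlich, *Simple factors in the Jacobian of a Fermat curve*, Canad. J. Math. **30** (1978) 1183–1205
  [KoblitzRohrlich1978] (held `paper:koblitz1978-simple-factors-jacobian-fermat-curve`, pp. 1187–1191 read), §2 Proposition and its proof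
  (p. 1190), quoted above.
* L. C. Washington, *Introduction to Cyclotomic Fields* [Washington1997], Cor. 4.4 (`B_{1,χ₀} ≠ 0` for odd primitive `χ₀`) and the
  Euler-factor formula — in the tree as `AokiFermatCMType.bernoulliOneChar_eq_zero_iff_of_odd` (`B_{1,χ} = 0 ⟺ χ₀(p) = 1` for some prime
  `p ∣ N`), which is the form of "`χ ∈ S₀(N)` iff there exists `p | N/N₀` such that `χ₀(p) = 1`" used here.

## What is proved

* §1 (any modulus `M ≥ 1`, any unit `u`; orthogonality `Σ_ψ ψ(a) = φ(M)·[a = 1]`, Mathlib `DirichletCharacter.sum_characters_eq`, and the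
  geometric sums `Σ_{i<ord u} ψ(uⁱ)`): `orderOf_mul_card_apply_eq_one` (`ord(u)·#{ψ : ψ(u) = 1} = φ(M)`),
  `two_mul_orderOf_mul_card_apply_eq_one_even` (`2·ord(u)·#{ψ even : ψ(u) = 1} = φ(M)` when no power of `u` is `−1`), hence **the printed
  per-prime count** `two_mul_orderOf_mul_card_odd_apply_eq_one`: **`2·ord(u)·#{ψ ODD : ψ(u) = 1} = φ(M)`** when no power of `u` is `−1`
  ("`½·#((ℤ/Nᵢℤ)*/{pᵢʲ})`"), and `card_odd_apply_eq_one_eq_zero`: **`#{ψ odd : ψ(u) = 1} = 0`** when some power of `u` is `−1` ("`0` if `pᵢ`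
  is a root of `−1 mod Nᵢ`"); together `two_mul_orderOf_mul_card_odd_apply_eq_one_le`.
* §2 `exists_changeLevel_eq_of_odd_of_bernoulliOneChar_eq_zero` — **the injection `χ ↦ (pᵢ, χ₀)`**: an odd `χ` modulo `N` with
  `B_{1,χ} = 0` is the lift of an ODD character `ψ` modulo `N_p = N/p^{v_p(N)}` with `ψ(p) = 1`, for some prime `p ∣ N`; hence
  **`card_odd_bernoulliOneChar_eq_zero_le`: `#S₀(N) ≤ Σ_{p ∣ N} #{ψ mod N_p odd : ψ(p) = 1}`**, and the interface
  `exists_goodFinset_of_sum_lt` to the sibling's hypothesis: `12·Σ_p #{…} < φ(N)` supplies a finset `S₀ ⊇ {bad odd χ}` with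
  `12·#S₀ < φ(N)`.

## Honest column / NOT here

* The ARITHMETIC half — that the resulting bound is `< #S(N)/6 = φ(N)/12` for every `N` prime to `6` (K–R's `s(N) < 1/6`, Table 1,
  Cases 1–4 and `m ≥ 5`) — is NOT typed here.
* Counts are stated with `Nat.card` of subtypes of `DirichletCharacter ℂ M` (no decidability instances in statements); K–R's quotient
  `(ℤ/Nᵢℤ)*/{pᵢʲ}` is not formed — the count is obtained by character orthogonality instead (same number).
* `#S(N) = φ(N)/2` (half the characters are odd, `N > 2`) is not restated; the sibling's hypothesis is written directly as `12·#S₀ < φ(N)`.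
* Private copies: `sum_characters_eq'` (roots-of-unity instance), `sum_range_orderOf_apply_pow`, `coe_pow_ne_one_of_lt_orderOf`,
  `not_even_of_odd`.

## References

* [KoblitzRohrlich1978] N. Koblitz, D. Rohrlich, Canad. J. Math. 30 (1978) 1183–1205: §2 Proposition and proof (p. 1190).
* [Washington1997] L. C. Washington, *Introduction to Cyclotomic Fields*, Cor. 4.4, Thm. 4.2.

## Provenance

Cell `pub-hodgecm2` (COR-CM), literature seat `lit-deligne-3` gen 34 (claim KR78-BADCOUNT F1; count-neutral, own lane).
-/

noncomputable section

open NumberField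

namespace Literature.AlgebraicGeometry.ComplexMultiplication

open Literature.NumberTheory.ComplexMultiplication
open Literature.NumberTheory.LFunctions
open DirichletCharacter

namespace CyclotomicFermatCMType

/-! ## §1 Counting Dirichlet characters with prescribed values on a unit and on `−1` -/

section Count

variable {M : ℕ} [NeZero M]

/-- Orthogonality `Σ_ψ ψ(a) = φ(M)·[a = 1]` (Mathlib `DirichletCharacter.sum_characters_eq`, with the roots-of-unity
instance supplied). [folklore] -/
private theorem sum_characters_eq' (a : ZMod M) :
    ∑ ψ : DirichletCharacter ℂ M, ψ a = if a = 1 then (M.totient : ℂ) else 0 := by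
  haveI : NeZero ((Monoid.exponent (ZMod M)ˣ : ℕ) : ℂ) :=
    ⟨Nat.cast_ne_zero.mpr Monoid.exponent_ne_zero_of_finite⟩
  exact DirichletCharacter.sum_characters_eq ℂ a

omit [NeZero M] in
/-- The geometric sum `Σ_{i<d} ψ(uⁱ)` over the order `d` of a unit `u`: `d` if `ψ(u) = 1`, else `0` (`ψ(u)` is a `d`-th root of
unity). [folklore] -/
private theorem sum_range_orderOf_apply_pow (ψ : DirichletCharacter ℂ M) (u : (ZMod M)ˣ) :
    ∑ i ∈ Finset.range (orderOf u), ψ ((u : ZMod M) ^ i) =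
      if ψ u = 1 then (orderOf u : ℂ) else 0 := by
  simp_rw [map_pow]
  split_ifs with h
  · simp only [h, one_pow, Finset.sum_const, Finset.card_range, nsmul_eq_mul, mul_one]
  · rw [geom_sum_eq h, ← map_pow, ← Units.val_pow_eq_pow_val, pow_orderOf_eq_one, Units.val_one, map_one,
      sub_self, zero_div]

omit [NeZero M] in
/-- `uⁱ ≠ 1` for `0 < i < ord(u)`, read in `ℤ/M`. [folklore] -/
private theorem coe_pow_ne_one_of_lt_orderOf (u : (ZMod M)ˣ) {i : ℕ} (hi0 : i ≠ 0) (hi : i < orderOf u) :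
    ((u : ZMod M) ^ i) ≠ 1 := by
  rw [← Units.val_pow_eq_pow_val]
  intro h
  exact pow_ne_one_of_lt_orderOf hi0 hi (Units.ext (h.trans Units.val_one.symm))

/-- **Characters trivial at a unit**: `ord(u) · #{ψ mod M : ψ(u) = 1} = φ(M)` (the characters trivial on the cyclic subgroup `⟨u⟩` of
`(ℤ/M)ˣ` are `|G|/|⟨u⟩| = #((ℤ/Mℤ)*/{uʲ})` in number — K–R's count "`#((ℤ/Nᵢℤ)*/{pᵢʲ})`" before halving; proof by `Σ_ψ Σ_{i<d} ψ(uⁱ)` and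
orthogonality). [cite: KoblitzRohrlich1978, §2 proof of the Proposition (p. 1190)] -/
theorem orderOf_mul_card_apply_eq_one (u : (ZMod M)ˣ) :
    orderOf u * Nat.card {ψ : DirichletCharacter ℂ M // ψ u = 1} = M.totient := by
  classical
  have key : ∑ ψ : DirichletCharacter ℂ M, ∑ i ∈ Finset.range (orderOf u), ψ ((u : ZMod M) ^ i) =
      (M.totient : ℂ) := by
    rw [Finset.sum_comm]
    simp_rw [sum_characters_eq']
    rw [Finset.sum_eq_single 0]
    · simp
    · intro i hi hi0
      rw [if_neg (coe_pow_ne_one_of_lt_orderOf u hi0 (Finset.mem_range.1 hi))]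
    · intro h
      exact absurd (Finset.mem_range.2 (orderOf_pos u)) h
  have key2 : ∑ ψ : DirichletCharacter ℂ M, ∑ i ∈ Finset.range (orderOf u), ψ ((u : ZMod M) ^ i) =
      (orderOf u : ℂ) * Nat.card {ψ : DirichletCharacter ℂ M // ψ u = 1} := by
    simp_rw [sum_range_orderOf_apply_pow]
    rw [Finset.sum_ite, Finset.sum_const_zero, add_zero, Finset.sum_const, nsmul_eq_mul, mul_comm,
      Nat.card_eq_fintype_card, Fintype.card_subtype]
  have e := key2.symm.trans key
  exact_mod_cast e

omit [NeZero M] in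
/-- A Dirichlet character with complex values is not both even and odd. [folklore] -/
private theorem not_even_of_odd {ψ : DirichletCharacter ℂ M} (ho : ψ.Odd) : ¬ψ.Even := by
  intro he
  have h : (1 : ℂ) = -1 := he.symm.trans ho
  norm_num at h

/-- **Even characters trivial at a unit**: if no power of `u` is `−1` then `2·ord(u) · #{ψ : ψ(u) = 1, ψ even} = φ(M)` (characters
trivial on `⟨u⟩ × {±1}`; `Σ_ψ Σ_{i<d} (ψ(uⁱ) + ψ(−uⁱ))` and orthogonality — the terms `ψ(−uⁱ)` contribute nothing since `−uⁱ ≠ 1`).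
[cite: KoblitzRohrlich1978, §2 proof of the Proposition (p. 1190)] -/
theorem two_mul_orderOf_mul_card_apply_eq_one_even (u : (ZMod M)ˣ) (hu : ∀ j : ℕ, u ^ j ≠ -1) :
    2 * orderOf u * Nat.card {ψ : DirichletCharacter ℂ M // ψ u = 1 ∧ ψ.Even} = M.totient := by
  classical
  have per : ∀ ψ : DirichletCharacter ℂ M,
      ∑ i ∈ Finset.range (orderOf u), (ψ ((u : ZMod M) ^ i) + ψ (-((u : ZMod M) ^ i))) =
        if ψ u = 1 ∧ ψ.Even then (2 * orderOf u : ℂ) else 0 := by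
    intro ψ
    have e : ∀ i : ℕ, ψ ((u : ZMod M) ^ i) + ψ (-((u : ZMod M) ^ i)) = (1 + ψ (-1)) * ψ ((u : ZMod M) ^ i) :=
      fun i => by rw [← neg_one_mul ((u : ZMod M) ^ i), map_mul]; ring
    simp_rw [e]
    rw [← Finset.mul_sum, sum_range_orderOf_apply_pow]
    rcases ψ.even_or_odd with he | ho
    · rw [show ψ (-1) = 1 from he]
      by_cases h1 : ψ u = 1
      · rw [if_pos h1, if_pos ⟨h1, he⟩]
        ring
      · rw [if_neg h1, if_neg fun h => h1 h.1, mul_zero]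
    · rw [show ψ (-1) = -1 from ho, if_neg (show ¬(ψ u = 1 ∧ ψ.Even) from fun h => not_even_of_odd ho h.2)]
      norm_num
  have h2 : ∀ i : ℕ, ¬(-((u : ZMod M) ^ i) = 1) := by
    intro i h
    refine hu i (Units.ext ?_)
    rw [Units.val_pow_eq_pow_val, Units.val_neg, Units.val_one]
    exact (neg_eq_iff_eq_neg.1 h)
  have key : ∑ ψ : DirichletCharacter ℂ M,
      ∑ i ∈ Finset.range (orderOf u), (ψ ((u : ZMod M) ^ i) + ψ (-((u : ZMod M) ^ i))) = (M.totient : ℂ) := by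
    have hz : ∀ i : ℕ, ∑ ψ : DirichletCharacter ℂ M, ψ (-((u : ZMod M) ^ i)) = 0 := fun i => by
      rw [sum_characters_eq', if_neg (h2 i)]
    rw [Finset.sum_comm]
    have hstep : ∀ i : ℕ, ∑ ψ : DirichletCharacter ℂ M, (ψ ((u : ZMod M) ^ i) + ψ (-((u : ZMod M) ^ i))) =
        if ((u : ZMod M) ^ i) = 1 then (M.totient : ℂ) else 0 := fun i => by
      rw [Finset.sum_add_distrib, hz, add_zero, sum_characters_eq']
    rw [Finset.sum_congr rfl fun i _ => hstep i, Finset.sum_eq_single 0]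
    · rw [pow_zero, if_pos rfl]
    · intro i hi hi0
      rw [if_neg (coe_pow_ne_one_of_lt_orderOf u hi0 (Finset.mem_range.1 hi))]
    · intro h
      exact absurd (Finset.mem_range.2 (orderOf_pos u)) h
  have key2 : ∑ ψ : DirichletCharacter ℂ M,
      ∑ i ∈ Finset.range (orderOf u), (ψ ((u : ZMod M) ^ i) + ψ (-((u : ZMod M) ^ i))) =
        (2 * orderOf u : ℂ) * Nat.card {ψ : DirichletCharacter ℂ M // ψ u = 1 ∧ ψ.Even} := by
    simp_rw [per]
    rw [Finset.sum_ite, Finset.sum_const_zero, add_zero, Finset.sum_const, nsmul_eq_mul, mul_comm,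
      Nat.card_eq_fintype_card, Fintype.card_subtype]
  have e := key2.symm.trans key
  exact_mod_cast e

/-- **Koblitz–Rohrlich's count**: for a unit `u` of `ℤ/M` no power of which is `−1`, the ODD characters `ψ` modulo `M` with `ψ(u) = 1` are
exactly `φ(M)/(2·ord(u))` in number: `2·ord(u) · #{ψ odd : ψ(u) = 1} = φ(M)` (K–R p. 1190, for `u = pᵢ` modulo `Nᵢ`: "For fixed `i`, the number
of such `χ₀` is `0` if `pᵢ` is a root of `−1 mod Nᵢ`, `½·#((ℤ/Nᵢℤ)*/{pᵢʲ})` otherwise"). [cite: KoblitzRohrlich1978, §2 proof of the Proposition (p. 1190)] -/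
theorem two_mul_orderOf_mul_card_odd_apply_eq_one (u : (ZMod M)ˣ) (hu : ∀ j : ℕ, u ^ j ≠ -1) :
    2 * orderOf u * Nat.card {ψ : DirichletCharacter ℂ M // ψ.Odd ∧ ψ u = 1} = M.totient := by
  classical
  have hA := orderOf_mul_card_apply_eq_one u
  have hB := two_mul_orderOf_mul_card_apply_eq_one_even u hu
  have hsplit : Nat.card {ψ : DirichletCharacter ℂ M // ψ u = 1} =
      Nat.card {ψ : DirichletCharacter ℂ M // ψ u = 1 ∧ ψ.Even} +
        Nat.card {ψ : DirichletCharacter ℂ M // ψ.Odd ∧ ψ u = 1} := by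
    simp only [Nat.card_eq_fintype_card, Fintype.card_subtype]
    rw [← Finset.card_filter_add_card_filter_not
      (s := Finset.univ.filter fun ψ : DirichletCharacter ℂ M => ψ u = 1) (fun ψ => ψ.Even),
      Finset.filter_filter, Finset.filter_filter]
    congr 1
    refine congrArg Finset.card (Finset.filter_congr fun ψ _ => ?_)
    constructor
    · rintro ⟨h1, hne⟩
      exact ⟨ψ.even_or_odd.resolve_left hne, h1⟩
    · rintro ⟨ho, h1⟩
      exact ⟨h1, not_even_of_odd ho⟩
  have hA' : ((orderOf u : ℕ) : ℤ) * (Nat.card {ψ : DirichletCharacter ℂ M // ψ u = 1} : ℕ) = (M.totient : ℕ) := by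
    exact_mod_cast hA
  have hB' : (2 : ℤ) * (orderOf u : ℕ) * (Nat.card {ψ : DirichletCharacter ℂ M // ψ u = 1 ∧ ψ.Even} : ℕ) =
      (M.totient : ℕ) := by
    exact_mod_cast hB
  have hs' : ((Nat.card {ψ : DirichletCharacter ℂ M // ψ u = 1} : ℕ) : ℤ) =
      (Nat.card {ψ : DirichletCharacter ℂ M // ψ u = 1 ∧ ψ.Even} : ℕ) +
        (Nat.card {ψ : DirichletCharacter ℂ M // ψ.Odd ∧ ψ u = 1} : ℕ) := by
    exact_mod_cast hsplit
  have goal : (2 : ℤ) * (orderOf u : ℕ) * (Nat.card {ψ : DirichletCharacter ℂ M // ψ.Odd ∧ ψ u = 1} : ℕ) =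
      (M.totient : ℕ) := by
    linear_combination 2 * hA' - hB' - 2 * ((orderOf u : ℕ) : ℤ) * hs'
  exact_mod_cast goal

omit [NeZero M] in
/-- **The killed case**: if some power of `u` is `−1` then NO odd character is trivial at `u` (`ψ(−1) = ψ(u)ʲ = 1`; K–R: "`0` if `pᵢ` is a
root of `−1 mod Nᵢ`"). [cite: KoblitzRohrlich1978, §2 proof of the Proposition (p. 1190)] -/
theorem card_odd_apply_eq_one_eq_zero (u : (ZMod M)ˣ) {j : ℕ} (hj : u ^ j = -1) :
    Nat.card {ψ : DirichletCharacter ℂ M // ψ.Odd ∧ ψ u = 1} = 0 := by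
  rw [Nat.card_eq_zero]
  left
  refine ⟨fun ⟨ψ, ho, h1⟩ => ?_⟩
  have h : ψ (-1) = 1 := by
    rw [show (-1 : ZMod M) = ((u ^ j : (ZMod M)ˣ) : ZMod M) by rw [hj, Units.val_neg, Units.val_one],
      Units.val_pow_eq_pow_val, map_pow, h1, one_pow]
  exact not_even_of_odd ho h

/-- Both cases at once: `2·ord(u) · #{ψ odd : ψ(u) = 1} ≤ φ(M)` for every unit `u`. [cite: KoblitzRohrlich1978, §2 proof of the Proposition (p. 1190)] -/
theorem two_mul_orderOf_mul_card_odd_apply_eq_one_le (u : (ZMod M)ˣ) :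
    2 * orderOf u * Nat.card {ψ : DirichletCharacter ℂ M // ψ.Odd ∧ ψ u = 1} ≤ M.totient := by
  by_cases hu : ∃ j : ℕ, u ^ j = -1
  · obtain ⟨j, hj⟩ := hu
    rw [card_odd_apply_eq_one_eq_zero u hj, mul_zero]
    exact Nat.zero_le _
  · exact (two_mul_orderOf_mul_card_odd_apply_eq_one u fun j hj => hu ⟨j, hj⟩).le

end Count

/-! ## §2 Koblitz–Rohrlich's injection: a bad odd character modulo `N` is the lift of an odd character modulo `Nₚ = N/p^{aₚ}` trivial at `p` -/

section Injection

open AokiFermatCMType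

variable {N : ℕ} [NeZero N]

/-- **"`χ ∈ S₀(N)` if and only if there exists `p | N/N₀` such that `χ₀(p) = 1` … the corresponding `χ₀` must be an odd character mod `Nᵢ`
such that `χ₀(pᵢ) = 1`"**: an ODD character `χ` modulo `N` with `B_{1,χ} = 0` is the lift `ψ ∘ (mod Nₚ)` of an odd character `ψ` modulo
`Nₚ = N/p^{v_p(N)}` with `ψ(p) = 1`, for some prime `p ∣ N` (`χ₀(p) = 1` forces `p ∤ cond χ`, so `cond χ ∣ Nₚ`; `ψ` = the level-`Nₚ`
character induced by `χ₀`). [cite: KoblitzRohrlich1978, §2 proof of the Proposition (p. 1190)] -/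
theorem exists_changeLevel_eq_of_odd_of_bernoulliOneChar_eq_zero {χ : DirichletCharacter ℂ N} (hodd : χ.Odd)
    (h0 : bernoulliOneChar χ = 0) :
    ∃ p ∈ N.primeFactors, ∃ (_ : NeZero (ordCompl[p] N)) (ψ : DirichletCharacter ℂ (ordCompl[p] N)),
      ψ.Odd ∧ ψ (p : ZMod (ordCompl[p] N)) = 1 ∧ changeLevel (Nat.ordCompl_dvd N p) ψ = χ := by
  obtain ⟨p, hp, hχp⟩ := (bernoulliOneChar_eq_zero_iff_of_odd hodd).1 h0
  have hpprime : p.Prime := Nat.prime_of_mem_primeFactors hp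
  haveI : NeZero χ.conductor := ⟨χ.conductor_ne_zero⟩
  have hpc : ¬p ∣ χ.conductor := by
    intro hd
    have hnu : ¬IsUnit ((p : ℕ) : ZMod χ.conductor) := by
      rw [ZMod.isUnit_iff_coprime, hpprime.coprime_iff_not_dvd]
      exact fun h => h hd
    rw [MulChar.map_nonunit _ hnu] at hχp
    exact zero_ne_one hχp
  have hcd : χ.conductor ∣ ordCompl[p] N := Nat.dvd_ordCompl_of_dvd_not_dvd χ.conductor_dvd_level hpc
  haveI hM : NeZero (ordCompl[p] N) := ⟨(Nat.ordCompl_pos p (NeZero.ne N)).ne'⟩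
  refine ⟨p, hp, hM, changeLevel hcd χ.primitiveCharacter, ?_, ?_, ?_⟩
  · rw [DirichletCharacter.Odd]
    have h := changeLevel_eq_cast_of_dvd' χ.primitiveCharacter hcd
      (show IsCoprime (-1 : ℤ) ((ordCompl[p] N : ℕ) : ℤ) from isCoprime_one_left.neg_left)
    rw [Int.cast_neg, Int.cast_one, Int.cast_neg, Int.cast_one] at h
    rw [h]
    exact RelativeClassNumber.Odd.primitiveCharacter hodd
  · have hcop : IsCoprime (p : ℤ) ((ordCompl[p] N : ℕ) : ℤ) :=
      Nat.isCoprime_iff_coprime.2 (Nat.coprime_ordCompl hpprime (NeZero.ne N))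
    have h := changeLevel_eq_cast_of_dvd' χ.primitiveCharacter hcd hcop
    rw [Int.cast_natCast, Int.cast_natCast] at h
    rw [h]
    exact hχp
  · rw [← changeLevel_trans]
    exact χ.changeLevel_primitiveCharacter

/-- **The Proposition's count, structural half**: `#S₀(N) ≤ Σ_{p ∣ N} #{ψ mod Nₚ odd : ψ(p) = 1}` — the number of ODD characters `χ`
modulo `N` with `B_{1,χ} = 0` is at most the number of pairs `(p, ψ)`, `p` a prime factor of `N`, `ψ` an odd character modulo
`Nₚ = N/p^{v_p(N)}` with `ψ(p) = 1` (K–R: "Thus `#S₀(N)/#S(N) ≤ Σᵢ …`", the injection `χ ↦ (pᵢ, χ₀)`). With §1: each summand is `0` if a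
power of `p` is `−1 (mod Nₚ)` and `φ(Nₚ)/(2·ord_{Nₚ}(p))` otherwise. [cite: KoblitzRohrlich1978, §2 Proposition and its proof (p. 1190)] -/
theorem card_odd_bernoulliOneChar_eq_zero_le :
    Nat.card {χ : DirichletCharacter ℂ N // χ.Odd ∧ bernoulliOneChar χ = 0} ≤
      ∑ p ∈ N.primeFactors,
        Nat.card {ψ : DirichletCharacter ℂ (ordCompl[p] N) // ψ.Odd ∧ ψ (p : ZMod (ordCompl[p] N)) = 1} := by
  classical
  haveI hM : ∀ p, NeZero (ordCompl[p] N) := fun p => ⟨(Nat.ordCompl_pos p (NeZero.ne N)).ne'⟩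
  let F : ℕ → Finset (DirichletCharacter ℂ N) := fun p =>
    (Finset.univ.filter fun ψ : DirichletCharacter ℂ (ordCompl[p] N) =>
      ψ.Odd ∧ ψ (p : ZMod (ordCompl[p] N)) = 1).image (changeLevel (Nat.ordCompl_dvd N p))
  have hsub : (Finset.univ.filter fun χ : DirichletCharacter ℂ N => χ.Odd ∧ bernoulliOneChar χ = 0) ⊆
      N.primeFactors.biUnion F := by
    intro χ hχ
    rw [Finset.mem_filter] at hχ
    obtain ⟨p, hp, _, ψ, hψ, hψp, hψχ⟩ := exists_changeLevel_eq_of_odd_of_bernoulliOneChar_eq_zero hχ.2.1 hχ.2.2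
    exact Finset.mem_biUnion.2 ⟨p, hp, Finset.mem_image.2
      ⟨ψ, Finset.mem_filter.2 ⟨Finset.mem_univ _, hψ, hψp⟩, hψχ⟩⟩
  rw [Nat.card_eq_fintype_card, Fintype.card_subtype]
  refine (Finset.card_le_card hsub).trans (Finset.card_biUnion_le.trans (Finset.sum_le_sum fun p _ => ?_))
  rw [Nat.card_eq_fintype_card, Fintype.card_subtype]
  exact Finset.card_image_le

/-- **The interface to the odd-level theorems**: if `12·Σ_{p ∣ N} #{ψ mod Nₚ odd : ψ(p) = 1} < φ(N)`, then there is a finset `S₀` containing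
every bad odd character with `12·#S₀ < φ(N)` — the hypothesis of `CyclotomicFermatCMTypesOddLevelSimple` §3–§5 (Koblitz–Rohrlich's
Theorems 1–2 in the relatively prime case at level `N`). [cite: KoblitzRohrlich1978, §2 Proposition (p. 1190)] -/
theorem exists_goodFinset_of_sum_lt
    (h : 12 * ∑ p ∈ N.primeFactors,
        Nat.card {ψ : DirichletCharacter ℂ (ordCompl[p] N) // ψ.Odd ∧ ψ (p : ZMod (ordCompl[p] N)) = 1} < N.totient) :
    ∃ S₀ : Finset (DirichletCharacter ℂ N),
      (∀ ψ : DirichletCharacter ℂ N, ψ.Odd → bernoulliOneChar ψ = 0 → ψ ∈ S₀) ∧ 12 * S₀.card < N.totient := by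
  classical
  refine ⟨Finset.univ.filter fun χ : DirichletCharacter ℂ N => χ.Odd ∧ bernoulliOneChar χ = 0,
    fun ψ hψ h0 => Finset.mem_filter.2 ⟨Finset.mem_univ _, hψ, h0⟩, lt_of_le_of_lt (Nat.mul_le_mul_left _ ?_) h⟩
  rw [← Fintype.card_subtype, ← Nat.card_eq_fintype_card]
  exact card_odd_bernoulliOneChar_eq_zero_le

end Injection

end CyclotomicFermatCMType

end Literature.AlgebraicGeometry.ComplexMultiplication
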